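import Literature.Analysis.DeBrangesSpaces.BurnolCosineKernelClosedForm
import Literature.Analysis.DeBrangesSpaces.SonineMellinEntire
import Literature.NumberTheory.ConnesConsani2021.SoninSpaceInfiniteDimensional
import Mathlib.Analysis.Calculus.Deriv.Star
import HarnessLib

/-!
# Burnol 2001 (CRAS 333), Théorème 1.4: the trivial zeros `1, 3, 5, …` are the ONLY common zeros of
# the Mellin transforms of `K_{a,b}` — proofs

LABEL (line 1): **RH-FREE** — Fourier analysis of the Sonine spaces `K_{a,b}` (functions vanishing on
`(0,a)` whose cosine transform vanishes on `(0,b)`); `ζ` does not occur. bears_on: LADDER-RH COLUMN 6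
(DBR), B-C/B-P, as corpus vocabulary only. WHAT THIS IS NOT: not a route, not a criterion; nothing here
bears on the truth of RH.

PROOF-ONLY companion of `BurnolSonineSpaces.lean` (J.-F. Burnol, *Sur certains espaces de Hilbert de
fonctions entières …*, C. R. Acad. Sci. Paris Sér. I **333** (2001) 201–206 = arXiv:math/0105120
[Burnol2001CRAS], TeX of record `dbl/src/Burnol2001CRAS_arXivmath0105120.tex`). It DISCHARGES the
named fact `Burnol2001CRAS_thm1_4` (Théorème 1.4, TeX l.369–392): for `a, b > 0`,
(i) every entire continuation of the Mellin transform of an `f ∈ K_{a,b}` vanishes at `1 + 2j` — this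
clause is `Burnol2001CRAS_thm1_4_i` of `SonineMellinEntire.lean` (seat dbl-t14), CITED; (ii) a complex
number at which all these Mellin transforms vanish is one of the `1 + 2j` ("ce sont leurs seuls zéros
communs") — proved here.

## The printed proof of (ii) (TeX l.374–390) and how it is followed

"Pour tout `w` et toute `f ∈ K_{a,b}` on a `f̂(w) = (𝓕₊(f), φ^w_{a,b}]` avec `φ^w_{a,b}(u) =
𝟙_{u≥b}(u) C_a(u,w)`. Donc si `w` est un zéro commun … `φ^w_{a,b} ∈ 𝓕₊(L²(]0,a])) + L²(]0,b])`. Dans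
l'écriture correspondante `φ = f_{a,b} + g_{a,b}` la fonction `f_{a,b}(u)` est une fonction entière de
`u` et elle est égale pour `u > b` à `C_a(u,w)` … on en déduit … soit `w ∈ {1+2j}` soit `Re(w) < 1/2`.
Mais ce dernier cas est à exclure car alors `C_a(u,w)` appartient à `𝓕₊(L²([a,∞[))` (et est non
nulle)."

The two analytic inputs of this argument are now tree theorems: (α) `L²(]0,a]) + 𝓕₊(L²(]0,b]))` is
closed — in the tree's even-`L²(ℝ)` realisation, `ran P_a ⊔ ran P̂_b` is closed,
`Literature.NumberTheory.ConnesConsani2021.isClosed_range_cutoffProj_sup_range_cutoffProjHat`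
(from `‖P_a P̂_b‖ < 1`), so that an EVEN vector orthogonal to Sonin's space `S(a,b) = K_{a,b}` lies in
`ran P_a ⊔ ran P̂_b` (`mem_sup_range_of_orthogonal`); (β) "`f_{a,b}` est une fonction entière" — an
element of `ran P̂_b` is a.e. the restriction of an entire function (Paley–Wiener, easy half:
`Literature.Analysis.Fourier.differentiable_fourierLaplace`), `exists_entire_ae_eq_of_mem_sup_range`.
With these:

* `Re w < 1/2` (`false_of_common_zero_of_re_lt_half`): here `f̂(w) = ∫_a^∞ f(t)t^{w−1}dt` converges and
  equals `½⟪q, f⟫` with `q = 𝟙_{|t|>a}|t|^{w̄−1} ∈ L²` (dbl-t14's `mellin_eq_half_integral`), so a common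
  zero makes the even vector `q` orthogonal to `K_{a,b}`, hence `q ∈ ran P_a ⊔ ran P̂_b`, hence (as
  `P_a q = 0`) `q` agrees off `[−a,a]` with an entire function `E`; then `E(t) = t^{w̄−1}` on `(a, ∞)`,
  so `E(z) = z^{w̄−1}` on `Re z > 0` (identity theorem) — impossible, `z^{w̄−1}` blows up at `0⁺`
  (`eq_zero_of_cpow_ae_eq_entire`). This is Burnol's "ce dernier cas est à exclure" (his
  `C_a(·,w) = 𝓕₊(𝟙_{t≥a}t^{w−1})`, transported by `𝓕₊`).
* `Re w ≥ 1/2` (`exists_eq_one_add_two_mul_of_common_zero`): `f̂(w) = G(w) = ∫_b^∞ 𝓕f(u) C_a(u,w) du`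
  (dbl-t14's `sonineMellinExt`, the printed (1.2)), so the even vector `q = 𝟙_{|u|>b} conj C_a(u,w)`
  is orthogonal to `𝓕(K_{a,b}) ⊇ K_{b,a}`, hence lies in `ran P_b ⊔ ran P̂_a`, hence `C_a(u,w)` agrees on
  `(b,∞)` with an entire function; by the closed form `C_a(u,w) = γ₊(w)u^{−w} − 2∫₀^a cos(2πut)t^{w−1}dt`
  (`IsBurnolC.eq_closedForm`, eq. (1.3), whose second term is entire in `u`) the function
  `γ₊(w)u^{−w}` agrees on `(b,∞)` with an entire function, forcing `γ₊(w) = 0`, i.e.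
  `cos(πw/2) = 0`, i.e. `w ∈ {1, 3, 5, …}` ("les seuls zéros de `γ₊(w)` étant en `1, 3, 5, …`").

No definitions, no new named facts (D-0026).

## References
* [Burnol2001CRAS] J.-F. Burnol, C. R. Acad. Sci. Paris Sér. I 333 (2001) 201–206 = arXiv:math/0105120,
  Théorème 1.4 and its proof (TeX l.369–392), Lemme 1.3 / eq. (1.3) (TeX l.352–367).
* [Burnol2004] J.-F. Burnol, *On Fourier and Zeta(s)*, Forum Math. 16 (2004), §6 (closedness of
  `L²(0,λ) + 𝓕₊L²(0,λ)`; tree file `SoninSpaceInfiniteDimensional.lean`).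
-/

noncomputable section

open _root_.MeasureTheory _root_.Complex _root_.Set _root_.Filter _root_.Metric
open scoped Real Topology FourierTransform InnerProductSpace ComplexConjugate
open Literature.NumberTheory.LFunctions (evenL2)
open Literature.NumberTheory.ConnesConsani2021 (cutoffProj cutoffProjHat soninSpace evenPart
  mem_soninSpace_iff_cutoffProj isStarProjection_cutoffProj isStarProjection_cutoffProjHat
  compNeg_cutoffProj compNeg_cutoffProjHat isClosed_range_cutoffProj_sup_range_cutoffProjHat
  cutoffProj_coeFn cutoffProjHat_coeFn_ae_eq_fourierInv mem_evenPart_iff)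
open Literature.Analysis.Fourier (coeFn_compNeg compNeg_compNeg fourier_compNeg
  fourier_fourier_eq_compNeg differentiable_fourierLaplace fourier_eq_fourierLaplace)
open Literature.Analysis.DeBrangesSpaces.SonineMellin (cosKernel sonineMellinExt cosKernel_neg
  differentiable_cosKernel cosKernel_eq_burnolC continuousOn_cosKernel exists_bound_cosKernel
  differentiable_sonineMellinExt sonineMellinExt_eq_mellin mellin_eq_half_integral)

namespace Literature.Analysis.DeBrangesSpaces

namespace Burnol2001

/-! ## A. Abstract tools: star projections -/

section Abstract

variable {E : Type*} [NormedAddCommGroup E] [InnerProductSpace ℂ E] [CompleteSpace E]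

/-- For a star projection `Q`, `Re ⟪x, Q x⟫ = ‖Q x‖²`. [folklore] -/
private theorem re_inner_apply_of_isStarProjection {Q : E →L[ℂ] E} (hQ : IsStarProjection Q)
    (x : E) : RCLike.re ⟪x, Q x⟫_ℂ = ‖Q x‖ ^ 2 := by
  have hQs := hQ.isSelfAdjoint.isSymmetric
  have h1 : Q (Q x) = Q x := congrArg (fun R : E →L[ℂ] E => R x) hQ.isIdempotentElem.eq
  have h2 : ⟪x, Q x⟫_ℂ = ⟪Q x, Q x⟫_ℂ := by
    calc ⟪x, Q x⟫_ℂ = ⟪x, Q (Q x)⟫_ℂ := by rw [h1]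
      _ = ⟪Q x, Q x⟫_ℂ := (hQs x (Q x)).symm
  rw [h2]
  exact inner_self_eq_norm_sq (𝕜 := ℂ) (Q x)

/-- For a star projection `P` and `z ⊥ ran P`: `P z = 0`. [folklore] -/
private theorem apply_eq_zero_of_mem_orthogonal_range {P : E →L[ℂ] E} (hP : IsStarProjection P)
    {z : E} (hz : z ∈ P.rangeᗮ) : P z = 0 := by
  have h1 : ⟪P z, z⟫_ℂ = 0 :=
    Submodule.inner_right_of_mem_orthogonal (LinearMap.mem_range_self (P : E →ₗ[ℂ] E) z) hz
  have h2 : RCLike.re ⟪z, P z⟫_ℂ = ‖P z‖ ^ 2 := re_inner_apply_of_isStarProjection hP z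
  rw [← inner_conj_symm, h1, map_zero, map_zero] at h2
  exact norm_eq_zero.1 (sq_eq_zero_iff.1 h2.symm)

/-- For a star projection `P` with `P z = 0`: `z ⊥ ran P`. [folklore] -/
private theorem mem_orthogonal_range_of_apply_eq_zero {P : E →L[ℂ] E} (hP : IsStarProjection P)
    {z : E} (hz : P z = 0) : z ∈ P.rangeᗮ := by
  rw [Submodule.mem_orthogonal]
  rintro u ⟨w, rfl⟩
  have hPs := hP.isSelfAdjoint.isSymmetric
  calc ⟪P w, z⟫_ℂ = ⟪w, P z⟫_ℂ := hPs w z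
    _ = 0 := by rw [hz, inner_zero_right]

/-- `(ran P ⊔ ran Q)ᗮ = ker P ∩ ker Q` for star projections. [folklore] -/
private theorem mem_orthogonal_sup_range_iff {P Q : E →L[ℂ] E} (hP : IsStarProjection P)
    (hQ : IsStarProjection Q) (z : E) :
    z ∈ (P.range ⊔ Q.range)ᗮ ↔ P z = 0 ∧ Q z = 0 := by
  rw [← Submodule.inf_orthogonal, Submodule.mem_inf]
  exact ⟨fun h ↦ ⟨apply_eq_zero_of_mem_orthogonal_range hP h.1,
      apply_eq_zero_of_mem_orthogonal_range hQ h.2⟩,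
    fun h ↦ ⟨mem_orthogonal_range_of_apply_eq_zero hP h.1,
      mem_orthogonal_range_of_apply_eq_zero hQ h.2⟩⟩

end Abstract

/-! ## B. An even vector orthogonal to `S(c, d)` lies in `ran P_c ⊔ ran P̂_d` -/

/-- An `L²` class fixed by the reflection is even. [folklore] -/
private theorem mem_evenPart_of_compNeg_eq {u : Lp ℂ 2 (volume : Measure ℝ)}
    (hu : Lp.compMeasurePreserving (fun x : ℝ ↦ -x) (Measure.measurePreserving_neg (volume : Measure ℝ))
      u = u) : u ∈ evenPart := by
  rw [mem_evenPart_iff]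
  have h := coeFn_compNeg (F := ℂ) u
  rw [hu] at h
  filter_upwards [h] with x hx
  exact hx.symm

/-- An even `L²` class is fixed by the reflection. [folklore] -/
private theorem compNeg_eq_of_mem_evenPart {u : Lp ℂ 2 (volume : Measure ℝ)} (hu : u ∈ evenPart) :
    Lp.compMeasurePreserving (fun x : ℝ ↦ -x) (Measure.measurePreserving_neg (volume : Measure ℝ))
      u = u := by
  refine Lp.ext ?_
  rw [mem_evenPart_iff] at hu
  filter_upwards [coeFn_compNeg (F := ℂ) u, hu] with x hx he
  rw [hx, he]

/-- **Input (α): an even vector orthogonal to Sonin's space `S(c,d)` lies in `ran P_c ⊔ ran P̂_d`**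
("`φ^w_{a,b} ∈ 𝓕₊(L²(]0,a])) + L²(]0,b])`", TeX l.380–381 — the sum is CLOSED,
`isClosed_range_cutoffProj_sup_range_cutoffProjHat`, and `S(c,d)` is the even part of its orthogonal
complement). [cite: Burnol2001CRAS, Théorème 1.4, proof (TeX l.378–381); Burnol2004, §6] -/
theorem mem_sup_range_of_orthogonal {c d : ℝ} {q : Lp ℂ 2 (volume : Measure ℝ)} (hq : q ∈ evenPart)
    (horth : ∀ s ∈ soninSpace c d, inner ℂ s q = 0) :
    q ∈ (cutoffProj c).range ⊔ (cutoffProjHat d).range := by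
  set R : Lp ℂ 2 (volume : Measure ℝ) →+ Lp ℂ 2 (volume : Measure ℝ) :=
    Lp.compMeasurePreserving (fun x : ℝ ↦ -x) (Measure.measurePreserving_neg (volume : Measure ℝ))
    with hRdef
  set P := cutoffProj c with hPdef
  set Q := cutoffProjHat d with hQdef
  have hP : IsStarProjection P := isStarProjection_cutoffProj c
  have hQ : IsStarProjection Q := isStarProjection_cutoffProjHat d
  set W : Submodule ℂ (Lp ℂ 2 (volume : Measure ℝ)) := P.range ⊔ Q.range with hWdef
  have hWc : IsClosed (W : Set (Lp ℂ 2 (volume : Measure ℝ))) :=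
    isClosed_range_cutoffProj_sup_range_cutoffProjHat c d
  haveI : CompleteSpace W := hWc.completeSpace_coe
  set k : Lp ℂ 2 (volume : Measure ℝ) := W.starProjection q with hkdef
  have hkW : k ∈ W := Submodule.starProjection_apply_mem W q
  have hqk : q - k ∈ Wᗮ := Submodule.sub_starProjection_mem_orthogonal q
  have hRW : ∀ w ∈ W, R w ∈ W := by
    intro w hw
    obtain ⟨p, hp, p', hp', rfl⟩ := Submodule.mem_sup.mp hw
    obtain ⟨x, rfl⟩ := LinearMap.mem_range.mp hp
    obtain ⟨y, rfl⟩ := LinearMap.mem_range.mp hp'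
    rw [map_add]
    refine Submodule.add_mem _ (Submodule.mem_sup_left ?_) (Submodule.mem_sup_right ?_)
    · exact LinearMap.mem_range.mpr ⟨R x, (compNeg_cutoffProj c x).symm⟩
    · exact LinearMap.mem_range.mpr ⟨R y, (compNeg_cutoffProjHat d y).symm⟩
  have hRWo : ∀ z ∈ Wᗮ, R z ∈ Wᗮ := by
    intro z hz
    obtain ⟨hPz, hQz⟩ := (mem_orthogonal_sup_range_iff hP hQ z).1 hz
    refine (mem_orthogonal_sup_range_iff hP hQ (R z)).2 ⟨?_, ?_⟩
    · change cutoffProj c (R z) = 0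
      rw [← compNeg_cutoffProj, show cutoffProj c z = 0 from hPz, map_zero]
    · change cutoffProjHat d (R z) = 0
      rw [← compNeg_cutoffProjHat, show cutoffProjHat d z = 0 from hQz, map_zero]
  have hRq : R q = q := compNeg_eq_of_mem_evenPart hq
  have hRk : R k = k := by
    have h1 : R k ∈ W := hRW k hkW
    have h2 : q - R k ∈ Wᗮ := by
      have := hRWo _ hqk
      rwa [map_sub, hRq] at this
    exact (Submodule.eq_starProjection_of_mem_orthogonal h1 h2).symm
  -- `q − k` is even and killed by `P`, `Q`: it lies in `S(c,d)`
  have hev : q - k ∈ evenPart := mem_evenPart_of_compNeg_eq (by rw [map_sub, hRq, hRk])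
  obtain ⟨hP0, hQ0⟩ := (mem_orthogonal_sup_range_iff hP hQ _).1 hqk
  have hS : q - k ∈ soninSpace c d := mem_soninSpace_iff_cutoffProj.2 ⟨hev, hP0, hQ0⟩
  -- hence `q − k ⊥ q` and `q − k ⊥ k`, so `q = k`
  have h1 : inner ℂ (q - k) q = 0 := horth _ hS
  have h2 : inner ℂ (q - k) k = 0 := Submodule.inner_left_of_mem_orthogonal hkW hqk
  have h3 : inner ℂ (q - k) (q - k) = 0 := by rw [inner_sub_right, h1, h2, sub_zero]
  have h4 : q - k = 0 := inner_self_eq_zero.1 h3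
  rw [sub_eq_zero.1 h4]
  exact hkW

/-! ## C. Input (β): vectors of `ran P̂_d` are restrictions of entire functions -/

/-- The indicator of `[−d, d]` times an `L²` function is integrable. [folklore] -/
private theorem integrable_indicator_Icc (d : ℝ) (V : Lp ℂ 2 (volume : Measure ℝ)) :
    Integrable ((Icc (-d) d).indicator (V : ℝ → ℂ)) := by
  rw [integrable_indicator_iff measurableSet_Icc, IntegrableOn, ← memLp_one_iff_integrable]
  exact ((Lp.memLp V).restrict (Icc (-d) d)).mono_exponent one_le_two

/-- **If `q ∈ ran P_c ⊔ ran P̂_d` and `P_c q = 0`, then off `[−c, c]` the class `q` agrees a.e. with an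
entire function** ("la fonction `f_{a,b}(u)` est une fonction entière de `u`", TeX l.382: `q = P̂_d y`
off `[−c,c]`, and `P̂_d y` is the inverse Fourier integral of the compactly supported integrable
function `𝟙_{[−d,d]}𝓕y`). [cite: Burnol2001CRAS, Théorème 1.4, proof (TeX l.381–383)] -/
theorem exists_entire_ae_eq_of_mem_sup_range {c d : ℝ} {q : Lp ℂ 2 (volume : Measure ℝ)}
    (hq : q ∈ (cutoffProj c).range ⊔ (cutoffProjHat d).range) (hP : cutoffProj c q = 0) :
    ∃ E : ℂ → ℂ, Differentiable ℂ E ∧ ∀ᵐ t : ℝ, t ∉ Icc (-c) c → q t = E t := by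
  obtain ⟨p, hp, p', hp', hpq⟩ := Submodule.mem_sup.mp hq
  obtain ⟨x, rfl⟩ := LinearMap.mem_range.mp hp
  obtain ⟨y, rfl⟩ := LinearMap.mem_range.mp hp'
  -- `q = P̂_d y − P_c (P̂_d y)`
  have hPP : cutoffProj c (cutoffProj c x) = cutoffProj c x := by
    have h := congrArg (fun T : Lp ℂ 2 (volume : Measure ℝ) →L[ℂ] Lp ℂ 2 (volume : Measure ℝ) ↦ T x)
      (Literature.NumberTheory.ConnesConsani2021.cutoffProj_idem c).eq
    simpa only [mul_apply_eq_comp] using h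
  have hpq' : (cutoffProj c x : Lp ℂ 2 (volume : Measure ℝ)) + cutoffProjHat d y = q := hpq
  have h1 : cutoffProj c x = -cutoffProj c (cutoffProjHat d y) := by
    have := congrArg (cutoffProj c) hpq'
    rw [map_add, hPP, hP] at this
    exact eq_neg_of_add_eq_zero_left this
  have hq_eq : q = cutoffProjHat d y - cutoffProj c (cutoffProjHat d y) := by
    rw [← hpq', h1]; abel
  -- the entire function
  set ψ : ℝ → ℂ := (Icc (-d) d).indicator ((𝓕 y : Lp ℂ 2 (volume : Measure ℝ)) : ℝ → ℂ) with hψ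
  have hψi : Integrable ψ := integrable_indicator_Icc d _
  have hψ0 : ∀ v, v ∉ Icc (-|d|) |d| → ψ v = 0 := by
    intro v hv
    rw [hψ, indicator_of_notMem]
    intro hv'
    exact hv ⟨(neg_le_neg (le_abs_self d)).trans hv'.1, hv'.2.trans (le_abs_self d)⟩
  set E : ℂ → ℂ := fun z ↦
    ∫ v : ℝ, Complex.exp (((-(2 * π * v) : ℝ) : ℂ) * (-z) * Complex.I) * ψ v with hE
  have hEd : Differentiable ℂ E :=
    (differentiable_fourierLaplace hψi (abs_nonneg d) hψ0).comp differentiable_neg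
  refine ⟨E, hEd, ?_⟩
  have hz := cutoffProjHat_coeFn_ae_eq_fourierInv d y
  filter_upwards [hz, cutoffProj_coeFn c (cutoffProjHat d y),
    Lp.coeFn_sub (cutoffProjHat d y) (cutoffProj c (cutoffProjHat d y))] with t ht1 ht2 ht3 ht
  rw [hq_eq, ht3, Pi.sub_apply, ht2, indicator_of_notMem ht, sub_zero, ht1,
    Real.fourierInv_eq_fourier_neg, fourier_eq_fourierLaplace, hE]
  simp only [Complex.ofReal_neg, hψ]

/-! ## D. A power `z^s`, `Re s < 0`, is not the restriction of an entire function -/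

/-- Two functions continuous on `(c, ∞)` that agree a.e. there agree everywhere there. [folklore] -/
private theorem eqOn_Ioi_of_ae_eq {c : ℝ} {f g : ℝ → ℂ} (hf : ContinuousOn f (Ioi c))
    (hg : ContinuousOn g (Ioi c)) (h : ∀ᵐ t : ℝ, c < t → f t = g t) : EqOn f g (Ioi c) := by
  intro t₀ ht₀
  by_contra hne
  -- `f − g ≠ 0` on a neighbourhood of `t₀` inside `(c, ∞)`, a set of positive measure
  have hc : ContinuousWithinAt (fun t ↦ f t - g t) (Ioi c) t₀ := (hf t₀ ht₀).sub (hg t₀ ht₀)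
  have hne' : f t₀ - g t₀ ≠ 0 := sub_ne_zero.2 hne
  have hopen : IsOpen {z : ℂ | z ≠ 0} := isOpen_ne
  have hmem : {t | f t - g t ≠ 0} ∈ 𝓝[Ioi c] t₀ := hc (hopen.mem_nhds hne')
  obtain ⟨U, hU, hUo, ht₀U⟩ :
      ∃ U : Set ℝ, U ⊆ {t | t ∈ Ioi c → f t - g t ≠ 0} ∧ IsOpen U ∧ t₀ ∈ U := by
    rcases mem_nhdsWithin.1 hmem with ⟨U, hUo, hU0, hU⟩
    exact ⟨U, fun t ht htc ↦ hU ⟨ht, htc⟩, hUo, hU0⟩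
  have hpos : 0 < volume (U ∩ Ioi c) := by
    have ho : IsOpen (U ∩ Ioi c) := hUo.inter isOpen_Ioi
    exact ho.measure_pos volume ⟨t₀, ht₀U, ht₀⟩
  have hzero : volume (U ∩ Ioi c) = 0 := by
    have hsub : U ∩ Ioi c ⊆ {t | ¬(c < t → f t = g t)} := by
      rintro t ⟨htU, htc⟩ himp
      exact hU htU htc (sub_eq_zero.2 (himp htc))
    exact measure_mono_null hsub (ae_iff.1 h)
  exact hpos.ne' hzero

/-- **`κ z^s` with `Re s < 0` cannot agree a.e. on a half-line `(c, ∞)`, `c ≥ 0`, with an entire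
function unless `κ = 0`**: the two agree on `Re z > 0` by the identity theorem, and `z^s` blows up
at `0⁺`. [folklore] -/
private theorem eq_zero_of_cpow_ae_eq_entire {c : ℝ} (hc : 0 ≤ c) {s : ℂ} (hs : s.re < 0) {κ : ℂ}
    {E : ℂ → ℂ} (hE : Differentiable ℂ E) (h : ∀ᵐ t : ℝ, c < t → κ * (t : ℂ) ^ s = E t) :
    κ = 0 := by
  by_contra hκ
  -- (1) pointwise agreement on `(c, ∞)`
  have hcpow : ∀ t : ℝ, 0 < t → ContinuousAt (fun y : ℝ ↦ κ * (y : ℂ) ^ s) t := fun t ht ↦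
    continuousAt_const.mul
      ((Complex.hasStrictDerivAt_cpow_const (c := s)
        (Complex.ofReal_mem_slitPlane.2 ht)).hasDerivAt.comp_ofReal.continuousAt)
  have hEq : EqOn (fun t : ℝ ↦ κ * (t : ℂ) ^ s) (fun t : ℝ ↦ E t) (Ioi c) :=
    eqOn_Ioi_of_ae_eq (fun t ht ↦ (hcpow t (hc.trans_lt ht)).continuousWithinAt)
      ((hE.continuous.comp Complex.continuous_ofReal).continuousOn) h
  -- (2) identity theorem on `U = {Re z > 0}`
  set U : Set ℂ := {z : ℂ | 0 < z.re} with hU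
  have hUo : IsOpen U := isOpen_lt continuous_const Complex.continuous_re
  have hUc : IsPreconnected U := (convex_halfSpace_re_gt 0).isPreconnected
  set F : ℂ → ℂ := fun z ↦ κ * z ^ s with hF
  have hFd : DifferentiableOn ℂ F U := by
    intro z hz
    have hz' : z ∈ slitPlane := Or.inl hz
    exact (((hasDerivAt_id z).cpow_const (c := s) hz').differentiableAt.const_mul κ).differentiableWithinAt
  have hFa : AnalyticOnNhd ℂ F U := hFd.analyticOnNhd hUo
  have hEa : AnalyticOnNhd ℂ E U := hE.differentiableOn.analyticOnNhd hUo
  set z₀ : ℂ := ((c + 1 : ℝ) : ℂ) with hz₀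
  have hz₀U : z₀ ∈ U := by change 0 < z₀.re; rw [hz₀, Complex.ofReal_re]; linarith
  -- the sequence `c + 1 + 1/(n+1)` of agreement points tends to `z₀` within `{z₀}ᶜ`
  set u : ℕ → ℂ := fun n ↦ ((c + 1 + 1 / ((n : ℝ) + 1) : ℝ) : ℂ) with hu
  have hu_lim : Tendsto u atTop (𝓝[≠] z₀) := by
    refine tendsto_nhdsWithin_iff.2 ⟨?_, Eventually.of_forall fun n ↦ ?_⟩
    · have h1 : Tendsto (fun n : ℕ ↦ c + 1 + 1 / ((n : ℝ) + 1)) atTop (𝓝 (c + 1)) := by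
        have := (tendsto_one_div_add_atTop_nhds_zero_nat).const_add (c + 1)
        rwa [add_zero] at this
      have := (Complex.continuous_ofReal.tendsto (c + 1)).comp h1
      rwa [hz₀]
    · rw [mem_compl_iff, mem_singleton_iff, hu, hz₀]
      intro h
      have h' := congrArg Complex.re h
      simp only [Complex.ofReal_re] at h'
      have : (0 : ℝ) < 1 / ((n : ℝ) + 1) := by positivity
      linarith
  have hfreq : ∃ᶠ z in 𝓝[≠] z₀, F z = E z := by
    refine hu_lim.frequently (Frequently.of_forall fun n ↦ ?_)
    have hn : c < c + 1 + 1 / ((n : ℝ) + 1) := by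
      have : (0 : ℝ) < 1 / ((n : ℝ) + 1) := by positivity
      linarith
    exact hEq hn
  have hFE : EqOn F E U := hFa.eqOn_of_preconnected_of_frequently_eq hEa hUc hz₀U hfreq
  -- (3) blow-up at `0⁺`: along `ε_n = 1/(n+1)`, `‖F ε_n‖ = ‖κ‖ (n+1)^{−Re s} → ∞`, `E ε_n → E 0`
  set ε : ℕ → ℝ := fun n ↦ 1 / ((n : ℝ) + 1) with hε
  have hεpos : ∀ n, 0 < ε n := fun n ↦ by rw [hε]; positivity
  have hεU : ∀ n, ((ε n : ℝ) : ℂ) ∈ U := fun n ↦ by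
    change 0 < ((ε n : ℝ) : ℂ).re; rw [Complex.ofReal_re]; exact hεpos n
  have hE0 : Tendsto (fun n ↦ ‖E ((ε n : ℝ) : ℂ)‖) atTop (𝓝 ‖E 0‖) := by
    have h1 : Tendsto (fun n ↦ ((ε n : ℝ) : ℂ)) atTop (𝓝 0) := by
      have := (Complex.continuous_ofReal.tendsto 0).comp tendsto_one_div_add_atTop_nhds_zero_nat
      rwa [Complex.ofReal_zero] at this
    exact ((hE.continuous.tendsto 0).comp h1).norm
  have hFn : ∀ n, ‖F ((ε n : ℝ) : ℂ)‖ = ‖κ‖ * ((n : ℝ) + 1) ^ (-s.re) := by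
    intro n
    rw [hF]; dsimp only
    rw [norm_mul, Complex.norm_cpow_eq_rpow_re_of_pos (hεpos n)]
    congr 1
    show (1 / ((n : ℝ) + 1)) ^ s.re = ((n : ℝ) + 1) ^ (-s.re)
    rw [one_div, Real.inv_rpow (by positivity), Real.rpow_neg (by positivity)]
  have hFtop : Tendsto (fun n ↦ ‖F ((ε n : ℝ) : ℂ)‖) atTop atTop := by
    simp_rw [hFn]
    refine Tendsto.const_mul_atTop (norm_pos_iff.2 hκ) ?_
    have h1 : Tendsto (fun n : ℕ ↦ (n : ℝ) + 1) atTop atTop :=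
      tendsto_natCast_atTop_atTop.atTop_add tendsto_const_nhds
    exact (tendsto_rpow_atTop (by linarith : 0 < -s.re)).comp h1
  have hsame : (fun n ↦ ‖F ((ε n : ℝ) : ℂ)‖) = fun n ↦ ‖E ((ε n : ℝ) : ℂ)‖ :=
    funext fun n ↦ by rw [hFE (hεU n)]
  rw [hsame] at hFtop
  exact hE0.not_tendsto (disjoint_nhds_atTop _) hFtop

/-! ## E. The case `Re w < 1/2`: "à exclure" -/

/-- The square-integrable weight `𝟙_{|x|>a}|x|^{s−1}` for `Re s < 1/2`, `a > 0`. [folklore] -/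
private theorem memLp_indicator_abs_cpow {a : ℝ} (ha : 0 < a) {s : ℂ} (hs : s.re < 1 / 2) :
    MemLp (Set.indicator {x : ℝ | a < |x|} (fun x : ℝ ↦ ((|x| : ℝ) : ℂ) ^ (s - 1))) 2 volume := by
  have hmeas : AEStronglyMeasurable
      (Set.indicator {x : ℝ | a < |x|} (fun x : ℝ ↦ ((|x| : ℝ) : ℂ) ^ (s - 1))) volume := by
    refine (aestronglyMeasurable_indicator_iff (measurableSet_lt measurable_const
      continuous_abs.measurable)).2 ?_
    refine ContinuousOn.aestronglyMeasurable (fun x hx ↦ ?_) (measurableSet_lt measurable_const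
      continuous_abs.measurable)
    have hx0 : (0 : ℝ) < |x| := ha.trans hx
    exact ((Complex.continuousAt_ofReal_cpow_const _ _ (Or.inr hx0.ne')).comp
      continuous_abs.continuousAt).continuousWithinAt
  rw [memLp_two_iff_integrable_sq_norm hmeas]
  -- `‖·‖² = 𝟙_{|x|>a} |x|^{2 Re s − 2}`, integrable on the two half-lines
  have hint : IntegrableOn (fun x : ℝ ↦ |x| ^ (2 * s.re - 2)) {x : ℝ | a < |x|} := by
    have hset : {x : ℝ | a < |x|} = Iio (-a) ∪ Ioi a := by
      ext x; simp only [mem_setOf_eq, mem_union, mem_Iio, mem_Ioi, lt_abs, lt_neg]; tauto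
    rw [hset]
    refine IntegrableOn.union ?_ ?_
    · have hneg : MeasurePreserving (fun x : ℝ ↦ -x) volume volume := Measure.measurePreserving_neg _
      have h3 := (hneg.integrableOn_comp_preimage (Homeomorph.neg ℝ).measurableEmbedding).2
        (integrableOn_Ioi_rpow_of_lt (by linarith : 2 * s.re - 2 < -1) ha)
      have h4 : (fun x : ℝ ↦ -x) ⁻¹' Ioi a = Iio (-a) := by
        ext x; simp only [mem_preimage, mem_Ioi, mem_Iio, lt_neg]
      rw [h4] at h3
      refine h3.congr_fun (fun x hx ↦ ?_) measurableSet_Iio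
      have hx' : x < 0 := lt_trans hx (neg_neg_of_pos ha)
      simp only [Function.comp_apply, abs_of_neg hx']
    · exact (integrableOn_Ioi_rpow_of_lt (by linarith : 2 * s.re - 2 < -1) ha).congr_fun
        (fun x hx ↦ by rw [abs_of_pos (ha.trans hx)]) measurableSet_Ioi
  have hint' : Integrable (Set.indicator {x : ℝ | a < |x|} (fun x : ℝ ↦ |x| ^ (2 * s.re - 2))) :=
    (integrable_indicator_iff (measurableSet_lt measurable_const continuous_abs.measurable)).2 hint
  refine hint'.congr (ae_of_all _ fun x ↦ ?_)
  dsimp only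
  by_cases hx : x ∈ {x : ℝ | a < |x|}
  · have hx0 : (0 : ℝ) < |x| := ha.trans hx
    rw [indicator_of_mem hx, indicator_of_mem hx, Complex.norm_cpow_eq_rpow_re_of_pos hx0,
      ← Real.rpow_natCast, ← Real.rpow_mul hx0.le]
    congr 1
    simp only [Complex.sub_re, Complex.one_re, Nat.cast_ofNat]
    ring
  · rw [indicator_of_notMem hx, indicator_of_notMem hx, norm_zero]
    norm_num

/-- **The case `Re w < 1/2` of Théorème 1.4 (ii) is impossible**: if every Mellin transform of
`K_{a,b}` vanishes at `w` with `Re w < 1/2`, then the even vector `q = 𝟙_{|t|>a}|t|^{w̄−1} ∈ L²` is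
orthogonal to `S(a,b)` (`f̂(w) = ½∫ f · 𝟙_{|t|>a}|t|^{w−1}`), so lies in `ran P_a ⊔ ran P̂_b`, so agrees
off `[−a,a]` with an entire function — but `t^{w̄−1}` does not extend ("ce dernier cas est à exclure car
alors `C_a(u,w)` appartient à `𝓕₊(L²([a,∞[))` (et est non nulle)", TeX l.388–390).
[cite: Burnol2001CRAS, Théorème 1.4, proof (TeX l.378–390)] -/
theorem false_of_common_zero_of_re_lt_half {a b : ℝ} (ha : 0 < a) (hb : 0 < b) {w : ℂ}
    (hw : w.re < 1 / 2)
    (H : ∀ f : Lp ℂ 2 (volume : Measure ℝ), f ∈ soninSpace a b → ∀ G : ℂ → ℂ,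
      HasEntireMellin f G → G w = 0) : False := by
  -- every `f ∈ K_{a,b}` has `mellin f w = 0`
  have hmel : ∀ f : Lp ℂ 2 (volume : Measure ℝ), f ∈ soninSpace a b →
      mellin (f : ℝ → ℂ) w = 0 := by
    intro f hf
    obtain ⟨G, hG⟩ := Burnol2001CRAS_thm1_1_holds a b ha hb f hf
    rw [← hG.2 w hw]
    exact H f hf G hG
  -- the vector `q`
  have hw' : (conj w).re < 1 / 2 := by rwa [Complex.conj_re]
  set qf : ℝ → ℂ := Set.indicator {x : ℝ | a < |x|} (fun x : ℝ ↦ ((|x| : ℝ) : ℂ) ^ (conj w - 1))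
    with hqf
  have hqm : MemLp qf 2 volume := memLp_indicator_abs_cpow ha hw'
  set q : Lp ℂ 2 (volume : Measure ℝ) := hqm.toLp qf with hqdef
  have hq_coe : (q : ℝ → ℂ) =ᵐ[volume] qf := hqm.coeFn_toLp
  -- `conj qf = 𝟙_{|x|>a}|x|^{w−1}`
  have hconj : ∀ x : ℝ, conj (qf x) =
      Set.indicator {x : ℝ | a < |x|} (fun x : ℝ ↦ ((|x| : ℝ) : ℂ) ^ (w - 1)) x := by
    intro x
    by_cases hx : x ∈ {x : ℝ | a < |x|}
    · rw [hqf, indicator_of_mem hx, indicator_of_mem hx]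
      have harg : ((|x| : ℝ) : ℂ).arg ≠ π := by
        rw [Complex.arg_ofReal_of_nonneg (abs_nonneg x)]; exact Real.pi_pos.ne
      have h := Complex.conj_cpow ((|x| : ℝ) : ℂ) (w - 1) harg
      rw [Complex.conj_ofReal] at h
      rw [h, map_sub, map_one]
    · rw [hqf, indicator_of_notMem hx, indicator_of_notMem hx, map_zero]
  -- `q` is even
  have hq_even : q ∈ evenPart := by
    rw [mem_evenPart_iff]
    have h2 := (Measure.measurePreserving_neg (volume : Measure ℝ)).quasiMeasurePreserving.ae_eq_comp
      hq_coe
    filter_upwards [hq_coe, h2] with x hx hx'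
    simp only [Function.comp_apply] at hx'
    rw [hx', hx, hqf]
    by_cases hxa : x ∈ {x : ℝ | a < |x|}
    · have hxa' : -x ∈ {x : ℝ | a < |x|} := by simpa only [mem_setOf_eq, abs_neg] using hxa
      rw [indicator_of_mem hxa, indicator_of_mem hxa', abs_neg]
    · have hxa' : -x ∉ {x : ℝ | a < |x|} := by simpa only [mem_setOf_eq, abs_neg] using hxa
      rw [indicator_of_notMem hxa, indicator_of_notMem hxa']
  -- `q ⊥ S(a, b)`
  have horth : ∀ s ∈ soninSpace a b, inner ℂ s q = 0 := by
    intro s hs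
    have hs' := hs
    obtain ⟨hse, hsa, -⟩ := hs'
    have h1 : inner ℂ q s = 0 := by
      rw [MeasureTheory.L2.inner_def]
      have h2 : (fun x : ℝ ↦ inner ℂ ((q : ℝ → ℂ) x) ((s : ℝ → ℂ) x)) =ᵐ[volume]
          fun x ↦ (s : ℝ → ℂ) x *
            Set.indicator {x : ℝ | a < |x|} (fun x : ℝ ↦ ((|x| : ℝ) : ℂ) ^ (w - 1)) x := by
        filter_upwards [hq_coe] with x hx
        rw [RCLike.inner_apply, hx, hconj]
      rw [integral_congr_ae h2]
      have h3 := mellin_eq_half_integral ha s hse hsa hw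
      rw [hmel s hs] at h3
      have h4 : (1 / 2 : ℂ) ≠ 0 := by norm_num
      exact (mul_eq_zero.1 h3.symm).resolve_left h4
    rw [← inner_conj_symm, h1, map_zero]
  -- hence `q ∈ ran P_a ⊔ ran P̂_b`, and `P_a q = 0`
  have hqW := mem_sup_range_of_orthogonal hq_even horth
  have hPq : cutoffProj a q = 0 := by
    refine Lp.ext ?_
    filter_upwards [cutoffProj_coeFn a q, hq_coe,
      Lp.coeFn_zero ℂ 2 (volume : Measure ℝ)] with t h1 h2 h3
    rw [h1, h3, Pi.zero_apply]
    by_cases ht : t ∈ Icc (-a) a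
    · rw [indicator_of_mem ht, h2, hqf, indicator_of_notMem]
      simp only [mem_setOf_eq, not_lt]
      exact abs_le.2 ⟨ht.1, ht.2⟩
    · rw [indicator_of_notMem ht]
  obtain ⟨E, hE, hqE⟩ := exists_entire_ae_eq_of_mem_sup_range hqW hPq
  -- on `(a, ∞)`: `t^{w̄−1} = E(t)` a.e.
  have hae : ∀ᵐ t : ℝ, a < t → (1 : ℂ) * (t : ℂ) ^ (conj w - 1) = E t := by
    filter_upwards [hqE, hq_coe] with t h1 h2 ht
    have ht0 : 0 < t := ha.trans ht
    have hnot : t ∉ Icc (-a) a := fun h ↦ (not_le.2 ht) h.2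
    rw [← h1 hnot, h2, hqf, indicator_of_mem (by simpa [abs_of_pos ht0] using ht), one_mul,
      abs_of_pos ht0]
  have hre : (conj w - 1).re < 0 := by
    rw [Complex.sub_re, Complex.conj_re, Complex.one_re]; linarith
  exact one_ne_zero (eq_zero_of_cpow_ae_eq_entire ha.le hre hE hae)

/-! ## F. The case `Re w ≥ 1/2`: `γ₊(w) = 0` -/

/-- `‖cos z‖ ≤ exp |Im z|`. [folklore] -/
private theorem norm_cos_le_exp_abs_im (z : ℂ) : ‖Complex.cos z‖ ≤ Real.exp |z.im| := by
  rw [Complex.cos, norm_div, Complex.norm_ofNat]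
  have h1 : ‖cexp (z * I)‖ ≤ Real.exp |z.im| := by
    rw [Complex.norm_exp, Complex.mul_I_re, Real.exp_le_exp]
    exact neg_le_abs _
  have h2 : ‖cexp (-z * I)‖ ≤ Real.exp |z.im| := by
    rw [Complex.norm_exp, Real.exp_le_exp]
    have : (-z * I).re = z.im := by simp
    rw [this]; exact le_abs_self _
  calc ‖cexp (z * I) + cexp (-z * I)‖ / 2 ≤ (‖cexp (z * I)‖ + ‖cexp (-z * I)‖) / 2 := by
        gcongr; exact norm_add_le _ _
    _ ≤ (Real.exp |z.im| + Real.exp |z.im|) / 2 := by gcongr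
    _ = Real.exp |z.im| := by ring

/-- **The second term of (1.3) is entire in `u`**: `z ↦ 2∫₀^a cos(2πzt) t^{w−1} dt` is entire for
`Re w > 0` (dominated holomorphic parametric integral on `(0, a]`).
[cite: Burnol2001CRAS, Lemme 1.3 (TeX l.356–360)] -/
theorem differentiable_integral_cos_mul_cpow {a : ℝ} (ha : 0 < a) {w : ℂ} (hw : 0 < w.re) :
    Differentiable ℂ fun z : ℂ ↦
      2 * ∫ t in Ioc 0 a, Complex.cos (2 * π * z * t) * (t : ℂ) ^ (w - 1) := by
  suffices hI : DifferentiableOn ℂ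
      (fun z : ℂ ↦ ∫ t in Ioc 0 a, Complex.cos (2 * π * z * t) * (t : ℂ) ^ (w - 1)) univ from
    (differentiable_const _).mul (differentiableOn_univ.1 hI)
  refine Literature.Analysis.Complex.differentiableOn_integral_of_dominated
    (μ := volume.restrict (Ioc 0 a))
    (F := fun (z : ℂ) (t : ℝ) ↦ Complex.cos (2 * π * z * t) * (t : ℂ) ^ (w - 1))
    (fun z _ ↦ ?_) ?_ (fun z₀ _ ↦ ?_)
  · refine (ContinuousOn.aestronglyMeasurable (fun t ht ↦ ?_) measurableSet_Ioc)
    have ht0 : (t : ℂ) ≠ 0 := by exact_mod_cast (ht.1 : 0 < t).ne'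
    exact ((by fun_prop : Continuous fun t : ℝ ↦ Complex.cos (2 * π * z * t)).continuousAt.mul
      (Complex.continuousAt_ofReal_cpow_const t (w - 1) (Or.inr ht.1.ne'))).continuousWithinAt
  · filter_upwards [ae_restrict_mem measurableSet_Ioc] with t ht
    exact ((((differentiable_const _).mul differentiable_id).mul (differentiable_const _)).ccos.mul
      (differentiable_const _)).differentiableOn
  · set B : ℝ := |z₀.im| + 1 with hB
    refine ⟨1, one_pos, subset_univ _,
      fun t ↦ Real.exp (2 * π * B * a) * t ^ (w.re - 1), ?_, ?_⟩
    · have h := (intervalIntegrable_iff_integrableOn_Ioc_of_le ha.le).1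
        (intervalIntegral.intervalIntegrable_rpow' (a := 0) (b := a) (by linarith : -1 < w.re - 1))
      exact h.const_mul _
    · filter_upwards [ae_restrict_mem measurableSet_Ioc] with t ht z hz
      have ht0 : 0 < t := ht.1
      rw [norm_mul, Complex.norm_cpow_eq_rpow_re_of_pos ht0, Complex.sub_re, Complex.one_re]
      refine mul_le_mul_of_nonneg_right ?_ (Real.rpow_nonneg ht0.le _)
      refine (norm_cos_le_exp_abs_im _).trans ?_
      rw [Real.exp_le_exp]
      have him : (2 * π * z * t : ℂ).im = 2 * π * t * z.im := by
        rw [show (2 * π * z * t : ℂ) = ((2 * π * t : ℝ) : ℂ) * z by push_cast; ring,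
          Complex.im_ofReal_mul]
      rw [him, abs_mul, abs_of_pos (by positivity : (0 : ℝ) < 2 * π * t)]
      have hz' : |z.im| ≤ B := by
        rw [mem_ball, Complex.dist_eq] at hz
        have h1 : |(z - z₀).im| ≤ ‖z - z₀‖ := Complex.abs_im_le_norm (z - z₀)
        rw [Complex.sub_im] at h1
        rw [hB]
        have := abs_sub_abs_le_abs_sub z.im z₀.im
        linarith
      calc 2 * π * t * |z.im| ≤ 2 * π * a * B :=
            mul_le_mul (mul_le_mul_of_nonneg_left ht.2 (by positivity)) hz' (abs_nonneg _)
              (by positivity)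
        _ = 2 * π * B * a := by ring

/-- The even square-integrable vector `𝟙_{|u|>b} conj C_a(u,w)` (`‖C_a(u,w)‖ ≤ K/|u|`, the `O(1/u)`
clause of Lemme 1.3). [cite: Burnol2001CRAS, Lemme 1.3 (TeX l.358–361)] -/
private theorem memLp_indicator_conj_cosKernel {a b : ℝ} (ha : 0 < a) (hb : 0 < b) (w : ℂ) :
    MemLp (Set.indicator {u : ℝ | b < |u|} (fun u : ℝ ↦ conj (cosKernel a u w))) 2 volume := by
  obtain ⟨K, hK0, hK⟩ := exists_bound_cosKernel ha hb ‖w‖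
  have hSm : MeasurableSet {u : ℝ | b < |u|} := measurableSet_lt measurable_const continuous_abs.measurable
  have hmeas : AEStronglyMeasurable
      (Set.indicator {u : ℝ | b < |u|} (fun u : ℝ ↦ conj (cosKernel a u w))) volume := by
    refine (aestronglyMeasurable_indicator_iff hSm).2 ?_
    refine ContinuousOn.aestronglyMeasurable ?_ hSm
    refine (Complex.continuous_conj.comp_continuousOn ((continuousOn_cosKernel ha w).mono ?_))
    intro u hu
    simp only [mem_setOf_eq] at hu ⊢
    exact abs_pos.1 (hb.trans hu)
  -- domination by the `L²` function `𝟙_{|u|>b} K/|u|`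
  have hdom : MemLp (Set.indicator {u : ℝ | b < |u|} (fun u : ℝ ↦ ((K / |u| : ℝ) : ℂ))) 2 volume := by
    have hm2 : AEStronglyMeasurable
        (Set.indicator {u : ℝ | b < |u|} (fun u : ℝ ↦ ((K / |u| : ℝ) : ℂ))) volume := by
      refine (aestronglyMeasurable_indicator_iff hSm).2 ?_
      refine ContinuousOn.aestronglyMeasurable (fun u hu ↦ ?_) hSm
      have hu0 : |u| ≠ 0 := (hb.trans hu).ne'
      exact (Complex.continuous_ofReal.continuousAt.comp
        (continuousAt_const.div continuous_abs.continuousAt hu0)).continuousWithinAt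
    rw [memLp_two_iff_integrable_sq_norm hm2]
    have hint : IntegrableOn (fun u : ℝ ↦ K ^ 2 * |u| ^ (-2 : ℝ)) {u : ℝ | b < |u|} := by
      have hset : {u : ℝ | b < |u|} = Iio (-b) ∪ Ioi b := by
        ext x; simp only [mem_setOf_eq, mem_union, mem_Iio, mem_Ioi, lt_abs, lt_neg]; tauto
      rw [hset]
      refine IntegrableOn.union ?_ ?_
      · have hneg : MeasurePreserving (fun x : ℝ ↦ -x) volume volume := Measure.measurePreserving_neg _
        have h3 := (hneg.integrableOn_comp_preimage (Homeomorph.neg ℝ).measurableEmbedding).2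
          ((integrableOn_Ioi_rpow_of_lt (by norm_num : (-2 : ℝ) < -1) hb).const_mul (K ^ 2))
        have h4 : (fun x : ℝ ↦ -x) ⁻¹' Ioi b = Iio (-b) := by
          ext x; simp only [mem_preimage, mem_Ioi, mem_Iio, lt_neg]
        rw [h4] at h3
        refine h3.congr_fun (fun x hx ↦ ?_) measurableSet_Iio
        have hx' : x < 0 := lt_trans hx (neg_neg_of_pos hb)
        simp only [Function.comp_apply, abs_of_neg hx']
      · have h5 : IntegrableOn (fun x : ℝ ↦ K ^ 2 * x ^ (-2 : ℝ)) (Ioi b) :=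
          (integrableOn_Ioi_rpow_of_lt (by norm_num : (-2 : ℝ) < -1) hb).const_mul (K ^ 2)
        exact h5.congr_fun (fun x hx ↦ by rw [abs_of_pos (hb.trans hx)]) measurableSet_Ioi
    have hint' : Integrable (Set.indicator {u : ℝ | b < |u|} (fun u : ℝ ↦ K ^ 2 * |u| ^ (-2 : ℝ))) :=
      (integrable_indicator_iff hSm).2 hint
    refine hint'.congr (ae_of_all _ fun u ↦ ?_)
    dsimp only
    by_cases hu : u ∈ {u : ℝ | b < |u|}
    · have hu0 : (0 : ℝ) < |u| := hb.trans hu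
      rw [indicator_of_mem hu, indicator_of_mem hu, Complex.norm_real, Real.norm_eq_abs,
        abs_div, abs_of_nonneg hK0, abs_abs, div_pow, Real.rpow_neg hu0.le, Real.rpow_two]
      ring
    · rw [indicator_of_notMem hu, indicator_of_notMem hu, norm_zero]
      norm_num
  refine MemLp.of_le hdom hmeas (ae_of_all _ fun u ↦ ?_)
  by_cases hu : u ∈ {u : ℝ | b < |u|}
  · rw [indicator_of_mem hu, indicator_of_mem hu, Complex.norm_conj, Complex.norm_real,
      Real.norm_of_nonneg (div_nonneg hK0 (abs_nonneg u))]
    exact hK u w (le_of_lt hu) le_rfl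
  · rw [indicator_of_notMem hu, indicator_of_notMem hu]

/-- The Fourier transform maps `S(b, a)` into `S(a, b)` and `𝓕 (𝓕 g) = g` there
(`K_{b,a} = 𝓕₊ K_{a,b}`, `𝓕₊² = 1`). [cite: Burnol2001CRAS, §1 (TeX l.271–273, 378–379)] -/
theorem fourier_mem_soninSpace_swap {a b : ℝ} {g : Lp ℂ 2 (volume : Measure ℝ)}
    (hg : g ∈ soninSpace b a) :
    (𝓕 g : Lp ℂ 2 (volume : Measure ℝ)) ∈ soninSpace a b ∧
      (𝓕 (𝓕 g : Lp ℂ 2 (volume : Measure ℝ)) : Lp ℂ 2 (volume : Measure ℝ)) = g := by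
  obtain ⟨hge, hgb, hga⟩ := hg
  have hRg : Lp.compMeasurePreserving (fun x : ℝ ↦ -x)
      (Measure.measurePreserving_neg (volume : Measure ℝ)) g = g := compNeg_eq_of_mem_evenPart hge
  have hFF : (𝓕 (𝓕 g : Lp ℂ 2 (volume : Measure ℝ)) : Lp ℂ 2 (volume : Measure ℝ)) = g := by
    rw [fourier_fourier_eq_compNeg, hRg]
  refine ⟨⟨?_, hga, ?_⟩, hFF⟩
  · exact mem_evenPart_of_compNeg_eq (by rw [← fourier_compNeg, hRg])
  · rw [hFF]; exact hgb

/-- **The case `Re w ≥ 1/2` of Théorème 1.4 (ii)**: if every Mellin transform of `K_{a,b}` vanishes at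
`w` with `Re w ≥ 1/2` then `γ₊(w) = 0`: the even vector `𝟙_{|u|>b} conj C_a(u,w)` is orthogonal to
`K_{b,a} ⊆ 𝓕₊(K_{a,b})` by (1.2), so `C_a(·,w)` agrees on `(b,∞)` with an entire function, so by (1.3)
`γ₊(w)u^{−w}` does, which forces `γ₊(w) = 0`. [cite: Burnol2001CRAS, Théorème 1.4, proof (TeX l.378–388)] -/
theorem gammaPlus_eq_zero_of_common_zero {a b : ℝ} (ha : 0 < a) (hb : 0 < b) {w : ℂ}
    (hw : 1 / 2 ≤ w.re)
    (H : ∀ f : Lp ℂ 2 (volume : Measure ℝ), f ∈ soninSpace a b → ∀ G : ℂ → ℂ,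
      HasEntireMellin f G → G w = 0) : gammaPlus w = 0 := by
  have hw0 : 0 < w.re := by linarith
  -- every `f ∈ K_{a,b}` has `G_f(w) = ∫_b^∞ 𝓕f(u) C_a(u,w) du = 0`
  have hG : ∀ f : Lp ℂ 2 (volume : Measure ℝ), f ∈ soninSpace a b →
      sonineMellinExt a b ((𝓕 f : Lp ℂ 2 (volume : Measure ℝ)) : ℝ → ℂ) w = 0 := by
    intro f hf
    obtain ⟨heven, hfa, hFb⟩ := hf
    exact H f ⟨heven, hfa, hFb⟩ _ ⟨differentiable_sonineMellinExt ha hb _,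
      fun s hs ↦ sonineMellinExt_eq_mellin ha hb f heven hfa hFb hs⟩
  -- the vector `q`
  set C : ℝ → ℂ := fun u ↦ cosKernel a u w with hC
  set qf : ℝ → ℂ := Set.indicator {u : ℝ | b < |u|} (fun u : ℝ ↦ conj (C u)) with hqf
  have hqm : MemLp qf 2 volume := memLp_indicator_conj_cosKernel ha hb w
  set q : Lp ℂ 2 (volume : Measure ℝ) := hqm.toLp qf with hqdef
  have hq_coe : (q : ℝ → ℂ) =ᵐ[volume] qf := hqm.coeFn_toLp
  have hC_even : ∀ u, C (-u) = C u := fun u ↦ cosKernel_neg a u w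
  -- `q` is even
  have hq_even : q ∈ evenPart := by
    rw [mem_evenPart_iff]
    have h2 := (Measure.measurePreserving_neg (volume : Measure ℝ)).quasiMeasurePreserving.ae_eq_comp
      hq_coe
    filter_upwards [hq_coe, h2] with x hx hx'
    simp only [Function.comp_apply] at hx'
    rw [hx', hx, hqf]
    by_cases hxa : x ∈ {u : ℝ | b < |u|}
    · have hxa' : -x ∈ {u : ℝ | b < |u|} := by simpa only [mem_setOf_eq, abs_neg] using hxa
      rw [indicator_of_mem hxa, indicator_of_mem hxa', hC_even]
    · have hxa' : -x ∉ {u : ℝ | b < |u|} := by simpa only [mem_setOf_eq, abs_neg] using hxa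
      rw [indicator_of_notMem hxa, indicator_of_notMem hxa']
  -- `q ⊥ S(b, a)`
  have horth : ∀ s ∈ soninSpace b a, inner ℂ s q = 0 := by
    intro g hg
    obtain ⟨hFg, hFFg⟩ := fourier_mem_soninSpace_swap hg
    have hge : ∀ᵐ x : ℝ, (g : ℝ → ℂ) (-x) = (g : ℝ → ℂ) x := hg.1
    -- `⟪q, g⟫ = ∫ 𝟙_{|u|>b} C(u) g(u) du = 2 ∫_b^∞ g C = 2 G_{𝓕 g}(w) = 0`
    have h0 := hG _ hFg
    rw [hFFg, sonineMellinExt] at h0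
    have hSm : MeasurableSet {u : ℝ | b < |u|} :=
      measurableSet_lt measurable_const continuous_abs.measurable
    have hint : Integrable (Set.indicator {u : ℝ | b < |u|} (fun u ↦ (g : ℝ → ℂ) u * C u)) := by
      have h1 : Integrable (fun u : ℝ ↦ conj ((q : ℝ → ℂ) u) * (g : ℝ → ℂ) u) := by
        have := L2.integrable_inner (𝕜 := ℂ) q g
        refine this.congr (ae_of_all _ fun u ↦ ?_)
        show inner ℂ _ _ = _
        rw [RCLike.inner_apply, mul_comm]
      refine h1.congr ?_
      filter_upwards [hq_coe] with u hu
      rw [hu, hqf]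
      by_cases hu' : u ∈ {u : ℝ | b < |u|}
      · rw [indicator_of_mem hu', indicator_of_mem hu', Complex.conj_conj, mul_comm]
      · rw [indicator_of_notMem hu', indicator_of_notMem hu', map_zero, zero_mul]
    have h1 : inner ℂ q g = 0 := by
      rw [MeasureTheory.L2.inner_def]
      have h2 : (fun x : ℝ ↦ inner ℂ ((q : ℝ → ℂ) x) ((g : ℝ → ℂ) x)) =ᵐ[volume]
          fun u ↦ Set.indicator {u : ℝ | b < |u|} (fun u ↦ (g : ℝ → ℂ) u * C u) u := by
        filter_upwards [hq_coe] with x hx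
        rw [RCLike.inner_apply, hx, hqf]
        by_cases hx' : x ∈ {u : ℝ | b < |u|}
        · rw [indicator_of_mem hx', indicator_of_mem hx', Complex.conj_conj]
        · rw [indicator_of_notMem hx', indicator_of_notMem hx', map_zero, mul_zero]
      rw [integral_congr_ae h2]
      -- reduce to an even integrable function
      have hge' : ∃ g' : ℝ → ℂ, (∀ x, g' (-x) = g' x) ∧ (g : ℝ → ℂ) =ᵐ[volume] g' := by
        refine ⟨fun x ↦ ((g : ℝ → ℂ) x + (g : ℝ → ℂ) (-x)) / 2, fun x ↦ by
          simp only [neg_neg]; ring, ?_⟩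
        filter_upwards [hge] with x hx
        rw [hx]; ring
      obtain ⟨g', hg'e, hgg'⟩ := hge'
      have hint' : IntegrableOn (fun u : ℝ ↦ g' u * C u) {u : ℝ | b < |u|} := by
        have h5 : IntegrableOn (fun u : ℝ ↦ (g : ℝ → ℂ) u * C u) {u : ℝ | b < |u|} :=
          (integrable_indicator_iff hSm).1 hint
        refine h5.congr_fun_ae ?_
        filter_upwards [ae_restrict_of_ae hgg'] with u hu
        rw [hu]
      have h3 : (fun u ↦ Set.indicator {u : ℝ | b < |u|} (fun u ↦ (g : ℝ → ℂ) u * C u) u)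
          =ᵐ[volume] fun u ↦ Set.indicator {u : ℝ | b < |u|} (fun u ↦ g' u * C u) u := by
        filter_upwards [hgg'] with u hu
        simp only [Set.indicator, hu]
      rw [integral_congr_ae h3, integral_indicator hSm]
      have hset : {u : ℝ | b < |u|} = Iio (-b) ∪ Ioi b := by
        ext x; simp only [mem_setOf_eq, mem_union, mem_Iio, mem_Ioi, lt_abs, lt_neg]; tauto
      have hdisj : Disjoint (Iio (-b)) (Ioi b) := by
        rw [Set.disjoint_iff]
        rintro x ⟨h1, h2⟩
        have : (x : ℝ) < -b := h1
        have : b < x := h2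
        linarith
      have hint1 : IntegrableOn (fun u : ℝ ↦ g' u * C u) (Iio (-b)) :=
        hint'.mono_set (by rw [hset]; exact subset_union_left)
      have hint2 : IntegrableOn (fun u : ℝ ↦ g' u * C u) (Ioi b) :=
        hint'.mono_set (by rw [hset]; exact subset_union_right)
      rw [hset, setIntegral_union hdisj measurableSet_Ioi hint1 hint2]
      have h4 : ∫ u in Iio (-b), g' u * C u = ∫ u in Ioi b, g' u * C u := by
        rw [← integral_Iic_eq_integral_Iio, ← integral_comp_neg_Ioi]
        exact setIntegral_congr_fun measurableSet_Ioi (fun u _ ↦ by rw [hg'e, hC_even])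
      have h5 : ∫ u in Ioi b, g' u * C u = ∫ u in Ioi b, (g : ℝ → ℂ) u * cosKernel a u w := by
        refine integral_congr_ae ?_
        filter_upwards [ae_restrict_of_ae hgg'] with u hu
        rw [hu]
      rw [h4, h5, h0, add_zero]
    rw [← inner_conj_symm, h1, map_zero]
  -- hence `q ∈ ran P_b ⊔ ran P̂_a`, `P_b q = 0`, and `q` is entire off `[−b, b]`
  have hqW := mem_sup_range_of_orthogonal hq_even horth
  have hPq : cutoffProj b q = 0 := by
    refine Lp.ext ?_
    filter_upwards [cutoffProj_coeFn b q, hq_coe,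
      Lp.coeFn_zero ℂ 2 (volume : Measure ℝ)] with t h1 h2 h3
    rw [h1, h3, Pi.zero_apply]
    by_cases ht : t ∈ Icc (-b) b
    · rw [indicator_of_mem ht, h2, hqf, indicator_of_notMem]
      simp only [mem_setOf_eq, not_lt]
      exact abs_le.2 ⟨ht.1, ht.2⟩
    · rw [indicator_of_notMem ht]
  obtain ⟨E, hE, hqE⟩ := exists_entire_ae_eq_of_mem_sup_range hqW hPq
  -- the conjugate entire function and the closed form (1.3)
  set Ebar : ℂ → ℂ := fun z ↦ conj (E (conj z)) with hEbar
  have hEbar_d : Differentiable ℂ Ebar := by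
    intro z
    have h := (hE (conj z)).conj_conj
    rw [Complex.conj_conj] at h
    exact h
  set D : ℂ → ℂ := fun z ↦ 2 * ∫ t in Ioc 0 a, Complex.cos (2 * π * z * t) * (t : ℂ) ^ (w - 1)
    with hD
  have hDd : Differentiable ℂ D := differentiable_integral_cos_mul_cpow ha hw0
  have hae : ∀ᵐ u : ℝ, b < u → gammaPlus w * (u : ℂ) ^ (-w) = Ebar u + D u := by
    filter_upwards [hqE, hq_coe] with u h1 h2 hu
    have hu0 : 0 < u := hb.trans hu
    have hnot : u ∉ Icc (-b) b := fun h ↦ (not_le.2 hu) h.2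
    have h3 : qf u = E u := by rw [← h2]; exact h1 hnot
    rw [hqf, indicator_of_mem (by simpa [abs_of_pos hu0] using hu)] at h3
    -- `C u = conj (E u) = Ebar u`
    have h4 : C u = Ebar u := by
      rw [hEbar]; dsimp only
      rw [Complex.conj_ofReal, ← h3, Complex.conj_conj]
    -- closed form: `C u = γ₊(w) u^{−w} − D u`
    have hBC : IsBurnolC a u (cosKernel a u) :=
      ⟨differentiable_cosKernel ha hu0.ne', fun z hz ↦ cosKernel_eq_burnolC ha hu0.ne' hz⟩
    have h5 := hBC.eq_closedForm ha hu0 hw0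
    have h6 : D u = 2 * ∫ t in Ioc 0 a, ((Real.cos (2 * π * u * t) : ℝ) : ℂ) * (t : ℂ) ^ (w - 1) := by
      rw [hD]; dsimp only
      congr 1
      refine setIntegral_congr_fun measurableSet_Ioc (fun t _ ↦ ?_)
      rw [Complex.ofReal_cos]; push_cast; ring_nf
    rw [← h4, hC]; dsimp only
    rw [h5, h6]; ring
  have hre : (-w).re < 0 := by rw [Complex.neg_re]; linarith
  exact eq_zero_of_cpow_ae_eq_entire hb.le hre (hEbar_d.add hDd) hae

/-- `γ₊(w) = 0` with `Re w > 0` forces `w ∈ {1, 3, 5, …}` ("les seuls zéros de `γ₊(w)` étant en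
`1, 3, 5, …`", TeX l.361). [cite: Burnol2001CRAS, §1 (TeX l.361)] -/
theorem exists_eq_one_add_two_mul_of_gammaPlus_eq_zero {w : ℂ} (hw : 0 < w.re)
    (h : gammaPlus w = 0) : ∃ j : ℕ, w = 1 + 2 * j := by
  have hπ : (π : ℂ) ≠ 0 := by exact_mod_cast Real.pi_ne_zero
  have h2π : (2 * π : ℂ) ≠ 0 := mul_ne_zero two_ne_zero hπ
  have hΓ : Complex.Gamma w ≠ 0 := Complex.Gamma_ne_zero_of_re_pos hw
  have hpow : (2 * π : ℂ) ^ (-w) ≠ 0 := by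
    rw [Ne, Complex.cpow_eq_zero_iff]; exact fun h' ↦ h2π h'.1
  have hcos : Complex.cos (π * w / 2) = 0 := by
    unfold gammaPlus at h
    rcases mul_eq_zero.1 h with h1 | h1
    · rcases mul_eq_zero.1 h1 with h2 | h2
      · rcases mul_eq_zero.1 h2 with h3 | h3
        · exact absurd h3 two_ne_zero
        · exact absurd h3 hpow
      · exact h2
    · exact absurd h1 hΓ
  obtain ⟨k, hk⟩ := Complex.cos_eq_zero_iff.1 hcos
  have hwk : w = 2 * k + 1 := by
    have h1 : (π : ℂ) * w = (2 * k + 1) * π := by linear_combination 2 * hk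
    exact mul_left_cancel₀ hπ (h1.trans (mul_comm _ _))
  have hk0 : 0 ≤ k := by
    have hre := congrArg Complex.re hwk
    simp at hre
    have : (0 : ℝ) < 2 * (k : ℝ) + 1 := by rw [← hre]; exact hw
    have : (-1 : ℝ) < 2 * (k : ℝ) := by linarith
    have : (-1 : ℤ) < 2 * k := by exact_mod_cast this
    omega
  refine ⟨k.toNat, ?_⟩
  rw [hwk]
  have h1 : ((k.toNat : ℕ) : ℂ) = ((k.toNat : ℤ) : ℂ) := (Int.cast_natCast k.toNat).symm
  rw [h1, Int.toNat_of_nonneg hk0]; ring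

/-! ## G. The discharge -/

/-- **Discharge of `Burnol2001CRAS_thm1_4`** (Burnol 2001, Théorème 1.4): for `a, b > 0`, (i) the
Mellin transforms of the functions of `K_{a,b}` all vanish at `1, 3, 5, …` (every entire continuation;
`Burnol2001CRAS_thm1_4_i` of seat dbl-t14), and (ii) these are their only common zeros.
[cite: Burnol2001CRAS, Théorème 1.4 (TeX l.369–392)] -/
theorem Burnol2001CRAS_thm1_4_holds : Burnol2001CRAS_thm1_4 := by
  intro a b ha hb
  refine ⟨fun f hf G hG j ↦ Burnol2001CRAS_thm1_4_i ha hb f hf G hG j, fun w H ↦ ?_⟩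
  rcases lt_or_ge w.re (1 / 2) with hw | hw
  · exact (false_of_common_zero_of_re_lt_half ha hb hw H).elim
  · exact exists_eq_one_add_two_mul_of_gammaPlus_eq_zero (by linarith)
      (gammaPlus_eq_zero_of_common_zero ha hb hw H)

end Burnol2001

end Literature.Analysis.DeBrangesSpaces
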